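import Summits.QuantumFields.QCD.Theorems.GaussianLinkFramesFrameAPrioriBoundLineDefs
import Literature.LinearAlgebra.Matrix.BorderedAdjugate
import Literature.MathematicalPhysics.QuantumFieldTheory.Multiboson
import Literature.MathematicalPhysics.QuantumLattice.WilsonDiracRangeOne
import Literature.MathematicalPhysics.QuantumLattice.GrassmannIntegralWilsonProofs

/-!
# Crux `FrameAPrioriBound` (stmt-QuantumFields-17374), line `cube-cofactor`: stub `portReduction`

PORT REDUCTION of the two-cube fibre `W ↦ hz (refit (touches x y) U W) m₀ z = H(refit W) − z`,
uniformly in `W`.  With `Λ` the quark indices at an endpoint of a touched link (the cubes plus the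
adjacent layer `∂`), the fibre matrix agrees with `H_U − z` off `Λ × Λ` (`hz_refit_apply_of_not`),
so along `Λ ⊕ ¬Λ` it is `fromBlocks A(W) B C E` with `B, C, E` the `W`-independent blocks of
`H_U − z`; for `Im z ≠ 0`, `E = H_U[¬Λ,¬Λ] − z` is invertible (`H_U` Hermitian) and the Schur
formulas (`Matrix.det_fromBlocks₂₂`, the tree's `adjugate_fromBlocks_inl_inl`) give the stub with
`c = det E` and the zero-padded port matrix `S = B' E⁻¹ B'ᴴ`, supported on `∂ × ∂` (rows of `B` at
cube sites vanish, `wilsonDirac_apply_eq_zero_of_not_adj`) and dissipative with the sign of `Im z`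
(`⟨v, S v⟩ = ⟨E u, u⟩`, `u = E⁻¹ B'ᴴ v`, `Im ⟨E u, u⟩ = Im(⟨u, H_E u⟩ − z̄‖u‖²) = Im z ‖u‖²`).
Pattern: `RandomRefit.det_wilsonDirac_twoStar_schur` / `adjugate_wilsonDirac_twoStar_schur`
(`Theorems/PauliWegnerSeaFibreCofactorDominationTwoStarSchur.lean`).  Elementary linear algebra.
-/

noncomputable section

namespace Summit.QuantumFields.QCD.Cruxes.FrameAPrioriBound.CubeCofactor

open scoped BigOperators Matrix
open MeasureTheory Filter Literature.MathematicalPhysics.QuantumFieldTheory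
  Literature.MathematicalPhysics.QuantumLattice Literature.Probability.LatticeModels

-- the index split `Λ ⊕ ¬Λ` needs a larger instance-size budget for `DecidableEq` of the sum
set_option synthInstance.maxSize 1024

namespace PortReduction

section PortAlgebra

variable {ι : Type*} [Fintype ι] [DecidableEq ι]

omit [Fintype ι] [DecidableEq ι] in
/-- Block form along `Λ ⊕ ¬Λ` of a matrix `M` that agrees with `M₀` off the `Λ × Λ` block. -/
theorem submatrix_sumCompl_eq_fromBlocks (Λ : ι → Prop) [DecidablePred Λ] (M M₀ : Matrix ι ι ℂ)
    (hM : ∀ p q, ¬ (Λ p ∧ Λ q) → M p q = M₀ p q) :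
    M.submatrix (Equiv.sumCompl Λ) (Equiv.sumCompl Λ) =
      Matrix.fromBlocks (M.toBlock Λ Λ) (M₀.toBlock Λ (fun p => ¬ Λ p))
        (M₀.toBlock (fun p => ¬ Λ p) Λ) (M₀.toBlock (fun p => ¬ Λ p) (fun p => ¬ Λ p)) := by
  ext (i | i) (j | j)
  · rfl
  · simpa [Matrix.toBlock_apply] using hM i j fun h => j.2 h.2
  · simpa [Matrix.toBlock_apply] using hM i j fun h => i.2 h.1
  · simpa [Matrix.toBlock_apply] using hM i j fun h => i.2 h.1

/-- Adjugate entries on `Λ × Λ` are read off the `Λ ⊕ ¬Λ` reindexing. -/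
theorem adjugate_eq_adjugate_submatrix_sumCompl (Λ : ι → Prop) [DecidablePred Λ] (N : Matrix ι ι ℂ)
    (p q : ι) (hp : Λ p) (hq : Λ q) :
    N.adjugate p q = (N.submatrix (Equiv.sumCompl Λ) (Equiv.sumCompl Λ)).adjugate
      (Sum.inl ⟨p, hp⟩) (Sum.inl ⟨q, hq⟩) := by
  rw [Matrix.adjugate_submatrix_equiv_self, Matrix.submatrix_apply, Equiv.sumCompl_apply_inl,
    Equiv.sumCompl_apply_inl]

/-- **Schur complement, determinant**: if `M` agrees with `M₀` off `Λ × Λ` and the exterior block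
`E = M₀[¬Λ,¬Λ]` has a unit determinant, `det M = det E · det (M[Λ,Λ] − M₀[Λ,¬Λ] E⁻¹ M₀[¬Λ,Λ])`. -/
theorem det_eq_det_toBlock_mul_det_schur (Λ : ι → Prop) [DecidablePred Λ] (M M₀ : Matrix ι ι ℂ)
    (hM : ∀ p q, ¬ (Λ p ∧ Λ q) → M p q = M₀ p q)
    (hE : IsUnit (M₀.toBlock (fun p => ¬ Λ p) (fun p => ¬ Λ p)).det) :
    M.det = (M₀.toBlock (fun p => ¬ Λ p) (fun p => ¬ Λ p)).det *
      (M.toBlock Λ Λ - M₀.toBlock Λ (fun p => ¬ Λ p) *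
        (M₀.toBlock (fun p => ¬ Λ p) (fun p => ¬ Λ p))⁻¹ * M₀.toBlock (fun p => ¬ Λ p) Λ).det := by
  haveI := Matrix.invertibleOfIsUnitDet _ hE
  rw [← Matrix.det_submatrix_equiv_self (Equiv.sumCompl Λ),
    submatrix_sumCompl_eq_fromBlocks Λ M M₀ hM, Matrix.det_fromBlocks₂₂,
    Matrix.invOf_eq_nonsing_inv]

/-- **Schur complement, cofactor block** (bordered adjugate): under the same hypotheses every
adjugate entry of `M` on `Λ × Λ` is `det E` times that of the Schur complement. -/
theorem adjugate_eq_det_toBlock_mul_adjugate_schur (Λ : ι → Prop) [DecidablePred Λ]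
    (M M₀ : Matrix ι ι ℂ) (hM : ∀ p q, ¬ (Λ p ∧ Λ q) → M p q = M₀ p q)
    (hE : IsUnit (M₀.toBlock (fun p => ¬ Λ p) (fun p => ¬ Λ p)).det) (p q : ι) (hp : Λ p)
    (hq : Λ q) :
    M.adjugate p q = (M₀.toBlock (fun p => ¬ Λ p) (fun p => ¬ Λ p)).det *
      (M.toBlock Λ Λ - M₀.toBlock Λ (fun p => ¬ Λ p) *
        (M₀.toBlock (fun p => ¬ Λ p) (fun p => ¬ Λ p))⁻¹ * M₀.toBlock (fun p => ¬ Λ p) Λ).adjugate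
        ⟨p, hp⟩ ⟨q, hq⟩ := by
  haveI := Matrix.invertibleOfIsUnitDet _ hE
  rw [adjugate_eq_adjugate_submatrix_sumCompl Λ M p q hp hq,
    submatrix_sumCompl_eq_fromBlocks Λ M M₀ hM,
    Literature.LinearAlgebra.Matrix.adjugate_fromBlocks_inl_inl, Matrix.invOf_eq_nonsing_inv]

omit [Fintype ι] in
/-- Block form of the CUT-AND-PADDED matrix `[M on Λ × Λ, identity elsewhere]` minus a matrix `S`
supported on `Λ × Λ`: along `Λ ⊕ ¬Λ` it is `fromBlocks (M[Λ,Λ] − S[Λ,Λ]) 0 0 1`. -/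
theorem padded_sub_submatrix_sumCompl (Λ : ι → Prop) [DecidablePred Λ] (M S : Matrix ι ι ℂ)
    (hS : ∀ p q, ¬ (Λ p ∧ Λ q) → S p q = 0) :
    (Matrix.of (fun p q : ι => if Λ p ∧ Λ q then M p q else if p = q then 1 else 0) - S).submatrix
        (Equiv.sumCompl Λ) (Equiv.sumCompl Λ) =
      Matrix.fromBlocks (M.toBlock Λ Λ - S.toBlock Λ Λ) 0 0 1 := by
  ext (i | i) (j | j)
  · simp [Matrix.toBlock_apply, i.2, j.2]
  · have hij : (i : ι) ≠ j := fun h => j.2 (h ▸ i.2)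
    simp [j.2, hij, hS i j (fun h => j.2 h.2)]
  · have hij : (i : ι) ≠ j := fun h => i.2 (h ▸ j.2)
    simp [i.2, hij, hS i j (fun h => i.2 h.1)]
  · simp [i.2, hS i j (fun h => i.2 h.1), Matrix.one_apply, Subtype.ext_iff]

/-- Determinant of the cut-and-padded matrix minus a `Λ × Λ`-supported `S`. -/
theorem det_padded_sub (Λ : ι → Prop) [DecidablePred Λ] (M S : Matrix ι ι ℂ)
    (hS : ∀ p q, ¬ (Λ p ∧ Λ q) → S p q = 0) :
    (Matrix.of (fun p q : ι => if Λ p ∧ Λ q then M p q else if p = q then 1 else 0) - S).det =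
      (M.toBlock Λ Λ - S.toBlock Λ Λ).det := by
  rw [← Matrix.det_submatrix_equiv_self (Equiv.sumCompl Λ), padded_sub_submatrix_sumCompl Λ M S hS,
    Matrix.det_fromBlocks_zero₂₁, Matrix.det_one, mul_one]

/-- Adjugate entries on `Λ × Λ` of the cut-and-padded matrix minus a `Λ × Λ`-supported `S`. -/
theorem adjugate_padded_sub (Λ : ι → Prop) [DecidablePred Λ] (M S : Matrix ι ι ℂ)
    (hS : ∀ p q, ¬ (Λ p ∧ Λ q) → S p q = 0) (p q : ι) (hp : Λ p) (hq : Λ q) :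
    (Matrix.of (fun p q : ι => if Λ p ∧ Λ q then M p q else if p = q then 1 else 0) - S).adjugate
        p q = (M.toBlock Λ Λ - S.toBlock Λ Λ).adjugate ⟨p, hp⟩ ⟨q, hq⟩ := by
  haveI : Invertible (1 : Matrix {a // ¬ Λ a} {a // ¬ Λ a} ℂ) := invertibleOne
  rw [adjugate_eq_adjugate_submatrix_sumCompl Λ _ p q hp hq,
    padded_sub_submatrix_sumCompl Λ M S hS,
    Literature.LinearAlgebra.Matrix.adjugate_fromBlocks_inl_inl]
  simp only [Matrix.det_one, one_mul, Matrix.zero_mul, sub_zero]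

omit [Fintype ι] [DecidableEq ι] in
/-- An entry of `X Y Z` vanishes when the corresponding row of `X` does. -/
theorem mul_mul_apply_eq_zero_of_row {n : Type*} [Fintype n] (X : Matrix ι n ℂ)
    (Y : Matrix n n ℂ) (Z : Matrix n ι ℂ) (p q : ι) (h : ∀ r, X p r = 0) :
    (X * Y * Z) p q = 0 := by
  simp [Matrix.mul_apply, h]

omit [Fintype ι] [DecidableEq ι] in
/-- An entry of `X Y Z` vanishes when the corresponding column of `Z` does. -/
theorem mul_mul_apply_eq_zero_of_col {n : Type*} [Fintype n] (X : Matrix ι n ℂ)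
    (Y : Matrix n n ℂ) (Z : Matrix n ι ℂ) (p q : ι) (h : ∀ r, Z r q = 0) :
    (X * Y * Z) p q = 0 := by
  simp [Matrix.mul_apply, h]

omit [DecidableEq ι] in
/-- The `Λ × Λ` block of the zero-padded port matrix `B' Y C'` is `M₀[Λ,¬Λ] Y M₀[¬Λ,Λ]`. -/
theorem toBlock_paddedPort (Λ : ι → Prop) [DecidablePred Λ] (M₀ : Matrix ι ι ℂ)
    (Y : Matrix {a // ¬ Λ a} {a // ¬ Λ a} ℂ) :
    ((Matrix.of fun (p : ι) (r : {a // ¬ Λ a}) => if Λ p then M₀ p r else 0) * Y *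
        (Matrix.of fun (r : {a // ¬ Λ a}) (q : ι) => if Λ q then M₀ r q else 0)).toBlock Λ Λ =
      M₀.toBlock Λ (fun p => ¬ Λ p) * Y * M₀.toBlock (fun p => ¬ Λ p) Λ := by
  ext i j
  simp [Matrix.toBlock_apply, Matrix.mul_apply, i.2, j.2]

/-- `⟨u, u⟩ = Σ |u_i|²` has zero imaginary part and non-negative real part. -/
theorem star_dotProduct_self_im_re {n : Type*} [Fintype n] (u : n → ℂ) :
    (star u ⬝ᵥ u).im = 0 ∧ 0 ≤ (star u ⬝ᵥ u).re := by
  have hw : ∀ w : ℂ, star w * w = ((‖w‖ ^ 2 : ℝ) : ℂ) := fun w => by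
    rw [Complex.ofReal_pow]
    exact Complex.conj_mul' w
  constructor
  · simp only [dotProduct, Pi.star_apply, hw, Complex.im_sum, Complex.ofReal_im,
      Finset.sum_const_zero]
  · simp only [dotProduct, Pi.star_apply, hw, Complex.re_sum, Complex.ofReal_re]
    exact Finset.sum_nonneg fun i _ => sq_nonneg _

/-- A Hermitian form `⟨u, H u⟩` is real. -/
theorem star_dotProduct_mulVec_im_of_isHermitian {n : Type*} [Fintype n] {H : Matrix n n ℂ}
    (hH : H.IsHermitian) (u : n → ℂ) : (star u ⬝ᵥ (H *ᵥ u)).im = 0 := by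
  apply Complex.conj_eq_iff_im.mp
  rw [starRingEnd_apply]
  conv_lhs => rw [Matrix.star_dotProduct, star_star, Matrix.star_mulVec, hH.eq,
    ← Matrix.dotProduct_mulVec]

/-- **Dissipativity of the port matrix.**  For `H` Hermitian, `M₀ = H − z`, `E = M₀[¬Λ,¬Λ]`
with unit determinant and zero-padded couplings `B' p r = 𝟙[Λ p] M₀ p r`, `C' r q = 𝟙[Λ q] M₀ r q`
(`C' = B'ᴴ`): `S = B' E⁻¹ C'` has `Im z · Im ⟨v, S v⟩ = (Im z)² ‖E⁻¹ C' v‖² ≥ 0`. -/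
theorem im_mul_im_star_dotProduct_port_nonneg (Λ : ι → Prop) [DecidablePred Λ] (H : Matrix ι ι ℂ)
    (hH : H.IsHermitian) (z : ℂ)
    (hE : IsUnit ((H - z • (1 : Matrix ι ι ℂ)).toBlock (fun p => ¬ Λ p) (fun p => ¬ Λ p)).det)
    (v : ι → ℂ) :
    0 ≤ z.im * (star v ⬝ᵥ (((Matrix.of fun (p : ι) (r : {a // ¬ Λ a}) =>
        if Λ p then (H - z • (1 : Matrix ι ι ℂ)) p r else 0) *
      ((H - z • (1 : Matrix ι ι ℂ)).toBlock (fun p => ¬ Λ p) (fun p => ¬ Λ p))⁻¹ *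
      (Matrix.of fun (r : {a // ¬ Λ a}) (q : ι) =>
        if Λ q then (H - z • (1 : Matrix ι ι ℂ)) r q else 0)) *ᵥ v)).im := by
  set M₀ : Matrix ι ι ℂ := H - z • (1 : Matrix ι ι ℂ) with hM₀
  set E := M₀.toBlock (fun p => ¬ Λ p) (fun p => ¬ Λ p) with hEdef
  set B' : Matrix ι {a // ¬ Λ a} ℂ := Matrix.of fun p r => if Λ p then M₀ p r else 0 with hB'
  set C' : Matrix {a // ¬ Λ a} ι ℂ := Matrix.of fun r q => if Λ q then M₀ r q else 0 with hC'
  have hBC : B'ᴴ = C' := by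
    ext r q
    simp only [hB', hC', Matrix.conjTranspose_apply, Matrix.of_apply]
    split_ifs with hq
    · have hqr : q ≠ (r : ι) := fun h => r.2 (h ▸ hq)
      simp [hM₀, Matrix.one_apply_ne hqr, Matrix.one_apply_ne (Ne.symm hqr), hH.apply]
    · exact star_zero ℂ
  set u : {a // ¬ Λ a} → ℂ := E⁻¹ *ᵥ (C' *ᵥ v) with hu
  have hEu : E *ᵥ u = C' *ᵥ v := by
    rw [hu, Matrix.mulVec_mulVec, Matrix.mul_nonsing_inv _ hE, Matrix.one_mulVec]
  have h1 : star v ⬝ᵥ ((B' * E⁻¹ * C') *ᵥ v) = star (E *ᵥ u) ⬝ᵥ u := by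
    rw [← Matrix.mulVec_mulVec, ← Matrix.mulVec_mulVec, ← hu, Matrix.dotProduct_mulVec, hEu,
      Matrix.star_mulVec, ← hBC, Matrix.conjTranspose_conjTranspose]
  set HE := H.toBlock (fun p => ¬ Λ p) (fun p => ¬ Λ p) with hHEdef
  have hHE : HE.IsHermitian := hH.submatrix _
  have hEeq : E = HE - z • 1 := by
    ext i j
    simp [hEdef, hHEdef, hM₀, Matrix.toBlock_apply, Matrix.one_apply, Subtype.ext_iff]
  have h2 : star (E *ᵥ u) ⬝ᵥ u = star u ⬝ᵥ (HE *ᵥ u) - star z * (star u ⬝ᵥ u) := by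
    rw [hEeq, Matrix.sub_mulVec, Matrix.smul_mulVec, Matrix.one_mulVec, star_sub, star_smul,
      sub_dotProduct, smul_dotProduct, Matrix.star_mulVec, hHE.eq, ← Matrix.dotProduct_mulVec,
      smul_eq_mul]
  have hzs : (star z).im = -z.im := Complex.conj_im z
  obtain ⟨hq1, hq2⟩ := star_dotProduct_self_im_re u
  rw [h1, h2, Complex.sub_im, star_dotProduct_mulVec_im_of_isHermitian hHE u, Complex.mul_im, hq1,
    mul_zero, zero_add, zero_sub, hzs, neg_mul, neg_neg, ← mul_assoc]
  exact mul_nonneg (mul_self_nonneg _) hq2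

/-- **Abstract port reduction.**  For `H` Hermitian, `Im z ≠ 0`, an index set `Λ` and a set `K`
whose rows and columns of `H − z` vanish outside `Λ`: there are `c ≠ 0` (`det` of the exterior
block of `H − z`) and `S` supported on `(Λ ∖ K)²`, dissipative with the sign of `Im z`, with
`det M = c · det(M' − S)`, `adj M = c · adj(M' − S)` on `Λ × Λ` for EVERY `M` agreeing with `H − z`
off `Λ × Λ` (`M'` = `M` cut to `Λ × Λ`, identity-padded). -/
theorem exists_portReduction (Λ K : ι → Prop) [DecidablePred Λ] (H : Matrix ι ι ℂ)
    (hH : H.IsHermitian) (z : ℂ) (hz0 : z.im ≠ 0)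
    (hK : ∀ p r, K p → ¬ Λ r →
      (H - z • (1 : Matrix ι ι ℂ)) p r = 0 ∧ (H - z • (1 : Matrix ι ι ℂ)) r p = 0) :
    ∃ (c : ℂ) (S : Matrix ι ι ℂ), c ≠ 0 ∧
      (∀ p q, S p q ≠ 0 → (Λ p ∧ ¬ K p) ∧ (Λ q ∧ ¬ K q)) ∧
      (∀ v : ι → ℂ, 0 ≤ z.im * (star v ⬝ᵥ (S *ᵥ v)).im) ∧
      ∀ M : Matrix ι ι ℂ, (∀ p q, ¬ (Λ p ∧ Λ q) → M p q = (H - z • (1 : Matrix ι ι ℂ)) p q) →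
        M.det = c * (Matrix.of (fun p q : ι =>
          if Λ p ∧ Λ q then M p q else if p = q then 1 else 0) - S).det ∧
        ∀ p q, Λ p → Λ q → M.adjugate p q = c * (Matrix.of (fun p q : ι =>
          if Λ p ∧ Λ q then M p q else if p = q then 1 else 0) - S).adjugate p q := by
  have hdiss := im_mul_im_star_dotProduct_port_nonneg Λ H hH z
  set M₀ : Matrix ι ι ℂ := H - z • (1 : Matrix ι ι ℂ) with hM₀
  set E := M₀.toBlock (fun p => ¬ Λ p) (fun p => ¬ Λ p) with hEdef
  set B' : Matrix ι {a // ¬ Λ a} ℂ := Matrix.of fun p r => if Λ p then M₀ p r else 0 with hB'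
  set C' : Matrix {a // ¬ Λ a} ι ℂ := Matrix.of fun r q => if Λ q then M₀ r q else 0 with hC'
  have hEeq : E = H.toBlock (fun p => ¬ Λ p) (fun p => ¬ Λ p) - z • 1 := by
    ext i j
    simp [hEdef, hM₀, Matrix.toBlock_apply, Matrix.one_apply, Subtype.ext_iff]
  have hEdet : E.det ≠ 0 := by
    rw [hEeq]
    exact det_sub_smul_one_ne_zero_of_isHermitian (hH.submatrix _) hz0
  have hE : IsUnit E.det := isUnit_iff_ne_zero.mpr hEdet
  set S : Matrix ι ι ℂ := B' * E⁻¹ * C' with hSdef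
  have hS0 : ∀ p q, ¬ (Λ p ∧ Λ q) → S p q = 0 := by
    intro p q h
    by_cases hp : Λ p
    · have hq : ¬ Λ q := fun hq => h ⟨hp, hq⟩
      exact mul_mul_apply_eq_zero_of_col B' E⁻¹ C' p q fun r => by simp [hC', hq]
    · exact mul_mul_apply_eq_zero_of_row B' E⁻¹ C' p q fun r => by simp [hB', hp]
  have hSΛ : S.toBlock Λ Λ =
      M₀.toBlock Λ (fun p => ¬ Λ p) * E⁻¹ * M₀.toBlock (fun p => ¬ Λ p) Λ := by
    rw [hSdef, hB', hC']
    exact toBlock_paddedPort Λ M₀ E⁻¹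
  refine ⟨E.det, S, hEdet, ?_, fun v => hdiss (hEdef ▸ hE) v, fun M hM => ⟨?_, fun p q hp hq => ?_⟩⟩
  · intro p q hSpq
    have hp : Λ p := by
      by_contra hp
      exact hSpq (mul_mul_apply_eq_zero_of_row B' E⁻¹ C' p q fun r => by simp [hB', hp])
    have hq : Λ q := by
      by_contra hq
      exact hSpq (mul_mul_apply_eq_zero_of_col B' E⁻¹ C' p q fun r => by simp [hC', hq])
    refine ⟨⟨hp, fun hKp => hSpq ?_⟩, ⟨hq, fun hKq => hSpq ?_⟩⟩
    · exact mul_mul_apply_eq_zero_of_row B' E⁻¹ C' p q fun r => by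
        simp [hB', (hK p r hKp r.2).1]
    · exact mul_mul_apply_eq_zero_of_col B' E⁻¹ C' p q fun r => by
        simp [hC', (hK q r hKq r.2).2]
  · rw [det_padded_sub Λ M S hS0, hSΛ]
    exact det_eq_det_toBlock_mul_det_schur Λ M M₀ hM hE
  · rw [adjugate_padded_sub Λ M S hS0 p q hp hq, hSΛ]
    exact adjugate_eq_det_toBlock_mul_adjugate_schur Λ M M₀ hM hE p q hp hq

end PortAlgebra

section Fibre

variable {L : ℕ}

/-- `x ∈ Q₂(x)`. -/
theorem inCube_self (x : TorusSite 4 L) : inCube x x = true := by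
  simp [inCube]

/-- A link with an endpoint in `Q₂(x) ∪ Q₂(y)` is touched. -/
theorem touches_iff (x y s : TorusSite 4 L) (μ : Fin 4) : touches x y (s, μ) = true ↔
    (inCube x s = true ∨ inCube y s = true) ∨
      (inCube x (Site.shift s μ) = true ∨ inCube y (Site.shift s μ) = true) := by
  simp [touches, or_assoc]

/-- **Exterior agreement, Wilson–Dirac.**  An entry `(p, q)` of `D_W(refit W)` off the `Λ × Λ`
block equals that of `D_W(U)`: the only links it reads join `p.1` and `q.1`, and a touched such
link would put both `p` and `q` in `Λ`. -/
theorem wilsonDirac_refit_apply_of_not (U W : GaugeConfig 4 L SU3) (m₀ r : ℝ)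
    (x y : TorusSite 4 L) (p q : TorusSite 4 L × Fin 3 × Fin 4)
    (h : ¬ ((∃ e : Edge 4 L, touches x y e = true ∧ (p.1 = e.1 ∨ p.1 = Site.shift e.1 e.2)) ∧
      (∃ e : Edge 4 L, touches x y e = true ∧ (q.1 = e.1 ∨ q.1 = Site.shift e.1 e.2)))) :
    wilsonDirac (fundamentalRep (Fin 3)) (refit (touches x y) U W) m₀ r p q =
      wilsonDirac (fundamentalRep (Fin 3)) U m₀ r p q := by
  have hU : ∀ e : Edge 4 L, (p.1 = e.1 ∨ p.1 = Site.shift e.1 e.2) →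
      (q.1 = e.1 ∨ q.1 = Site.shift e.1 e.2) → refit (touches x y) U W e = U e := by
    intro e hp hq
    have ht : ¬ (touches x y e = true) := fun ht => h ⟨⟨e, ht, hp⟩, ⟨e, ht, hq⟩⟩
    simp [refit, ht]
  simp only [wilsonDirac, Matrix.of_apply]
  congr 1
  congr 1
  refine Finset.sum_congr rfl fun μ _ => ?_
  congr 1
  · split_ifs with hq
    exacts [by rw [hU (p.1, μ) (Or.inl rfl) (Or.inr hq)], rfl]
  · split_ifs with hp
    exacts [by rw [hU (q.1, μ) (Or.inr hp) (Or.inl rfl)], rfl]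

/-- **Exterior agreement** for the shifted Hermitian kernel `hz = γ₅ D_W − z`
(`γ₅` acts diagonally, `spinorLift_gammaFive_eq_diagonal`). -/
theorem hz_refit_apply_of_not [NeZero L] (U W : GaugeConfig 4 L SU3) (m₀ : ℝ) (z : ℂ)
    (x y : TorusSite 4 L) (p q : TorusSite 4 L × Fin 3 × Fin 4)
    (h : ¬ ((∃ e : Edge 4 L, touches x y e = true ∧ (p.1 = e.1 ∨ p.1 = Site.shift e.1 e.2)) ∧
      (∃ e : Edge 4 L, touches x y e = true ∧ (q.1 = e.1 ∨ q.1 = Site.shift e.1 e.2)))) :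
    hz (refit (touches x y) U W) m₀ z p q = hz U m₀ z p q := by
  simp only [hz, Matrix.sub_apply, spinorLift_gammaFive_eq_diagonal, Matrix.diagonal_mul,
    wilsonDirac_refit_apply_of_not U W m₀ 1 x y p q h]

/-- **Cube rows and columns vanish outside `Λ`.**  If `p` sits at a cube site and `r` is off
every touched link, then `hz U p r = 0 = hz U r p`: `p ≠ r`, and `r.1` is no `p.1 ± μ̂` (those
links have an endpoint in the cube, hence are touched), so the range-one Wilson–Dirac entries
vanish (`wilsonDirac_apply_eq_zero_of_not_adj`), and so does the off-diagonal `z`-part. -/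
theorem hz_apply_eq_zero_of_inCube [NeZero L] (U : GaugeConfig 4 L SU3) (m₀ : ℝ) (z : ℂ)
    (x y : TorusSite 4 L) (p r : TorusSite 4 L × Fin 3 × Fin 4)
    (hp : inCube x p.1 = true ∨ inCube y p.1 = true)
    (hr : ¬ ∃ e : Edge 4 L, touches x y e = true ∧ (r.1 = e.1 ∨ r.1 = Site.shift e.1 e.2)) :
    hz U m₀ z p r = 0 ∧ hz U m₀ z r p = 0 := by
  have hρ : ∀ g : SU3, fundamentalRep (Fin 3) g ∈ Matrix.unitaryGroup (Fin 3) ℂ :=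
    fundamentalRep_mem_unitaryGroup
  have h1 : ∀ μ : Fin 4, r.1 ≠ Site.shift p.1 μ := fun μ h =>
    hr ⟨(p.1, μ), (touches_iff x y p.1 μ).2 (Or.inl hp), Or.inr h⟩
  have h2 : ∀ μ : Fin 4, p.1 ≠ Site.shift r.1 μ := fun μ h =>
    hr ⟨(r.1, μ), (touches_iff x y r.1 μ).2 (Or.inr (h ▸ hp)), Or.inl rfl⟩
  have hpr : p ≠ r := fun h =>
    hr ⟨(r.1, 0), (touches_iff x y r.1 0).2 (Or.inl (h ▸ hp)), Or.inl rfl⟩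
  simp [hz, Matrix.sub_apply, spinorLift_gammaFive_eq_diagonal, Matrix.diagonal_mul,
    wilsonDirac_apply_eq_zero_of_not_adj _ hρ U m₀ hpr h1 h2, Matrix.one_apply_ne hpr,
    wilsonDirac_apply_eq_zero_of_not_adj _ hρ U m₀ hpr.symm (fun μ h => h2 μ h) fun μ h => h1 μ h,
    Matrix.one_apply_ne hpr.symm]

end Fibre

end PortReduction

open PortReduction in
/-- STUB `portReduction` (size M — port reduction of the two-cube fibre, W-uniform).  With `Λ`
the endpoints of the touched links (`Q₂(x) ∪ Q₂(y)` plus the adjacent layer `∂`) and `Im z ≠ 0`: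
there are `c ≠ 0` (`c = det E`, `E = (H_U − z)[¬Λ,¬Λ]` the `W`-independent exterior block,
invertible as `H_U` is Hermitian) and a `W`-independent `S = B' E⁻¹ B'ᴴ` (zero-padded), supported
on `∂ × ∂` and dissipative with the sign of `Im z`, such that for EVERY `W` the determinant and
the `(x, y)` adjugate block of `H(refit W) − z` are `c` times those of
`[H(refit W) − z cut to Λ × Λ, identity-padded] − S` (`exists_portReduction` at `H = γ₅ D_W(U)`,
`K` = the two cubes). -/
theorem stub_portReduction : ∀ (L : ℕ) [NeZero L], 4 ≤ L → ∀ (m₀ : ℝ) (z : ℂ), z.im ≠ 0 →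
    ∀ (x y : TorusSite 4 L) (U : GaugeConfig 4 L SU3),
    ∃ (c : ℂ) (S : Matrix (TorusSite 4 L × Fin 3 × Fin 4) (TorusSite 4 L × Fin 3 × Fin 4) ℂ),
      c ≠ 0 ∧
      (∀ p q, S p q ≠ 0 →
        ((∃ e : Edge 4 L, touches x y e = true ∧ (p.1 = e.1 ∨ p.1 = Site.shift e.1 e.2)) ∧
            ¬ (inCube x p.1 = true ∨ inCube y p.1 = true)) ∧
        ((∃ e : Edge 4 L, touches x y e = true ∧ (q.1 = e.1 ∨ q.1 = Site.shift e.1 e.2)) ∧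
            ¬ (inCube x q.1 = true ∨ inCube y q.1 = true))) ∧
      (∀ v : TorusSite 4 L × Fin 3 × Fin 4 → ℂ, 0 ≤ z.im * (star v ⬝ᵥ (S *ᵥ v)).im) ∧
      ∀ W : GaugeConfig 4 L SU3,
        (hz (refit (touches x y) U W) m₀ z).det =
          c * (Matrix.of (fun p q : TorusSite 4 L × Fin 3 × Fin 4 =>
              if (∃ e : Edge 4 L, touches x y e = true ∧ (p.1 = e.1 ∨ p.1 = Site.shift e.1 e.2)) ∧
                  (∃ e : Edge 4 L, touches x y e = true ∧ (q.1 = e.1 ∨ q.1 = Site.shift e.1 e.2))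
              then (hz (refit (touches x y) U W) m₀ z) p q else if p = q then 1 else 0) - S).det ∧
        ∀ (a : Fin 3) (i : Fin 4) (b : Fin 3) (j : Fin 4),
          (hz (refit (touches x y) U W) m₀ z).adjugate (x, a, i) (y, b, j) =
            c * (Matrix.of (fun p q : TorusSite 4 L × Fin 3 × Fin 4 =>
              if (∃ e : Edge 4 L, touches x y e = true ∧ (p.1 = e.1 ∨ p.1 = Site.shift e.1 e.2)) ∧
                  (∃ e : Edge 4 L, touches x y e = true ∧ (q.1 = e.1 ∨ q.1 = Site.shift e.1 e.2))
              then (hz (refit (touches x y) U W) m₀ z) p q else if p = q then 1 else 0) - S).adjugate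
              (x, a, i) (y, b, j) := by
  intro L _ _ m₀ z hz0 x y U
  obtain ⟨c, S, hc, hsupp, hdiss, hmain⟩ := exists_portReduction
    (fun p : TorusSite 4 L × Fin 3 × Fin 4 =>
      ∃ e : Edge 4 L, touches x y e = true ∧ (p.1 = e.1 ∨ p.1 = Site.shift e.1 e.2))
    (fun p : TorusSite 4 L × Fin 3 × Fin 4 => inCube x p.1 = true ∨ inCube y p.1 = true)
    (spinorLift gammaFive * wilsonDirac (fundamentalRep (Fin 3)) U m₀ 1)
    (isHermitian_gammaFive_mul_wilsonDirac_fundamental U m₀ 1) z hz0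
    (fun p r hp hr => hz_apply_eq_zero_of_inCube U m₀ z x y p r hp hr)
  refine ⟨c, S, hc, hsupp, hdiss, fun W => ?_⟩
  obtain ⟨hdet, hadj⟩ := hmain (hz (refit (touches x y) U W) m₀ z)
    (fun p q h => hz_refit_apply_of_not U W m₀ z x y p q h)
  exact ⟨hdet, fun a i b j => hadj (x, a, i) (y, b, j)
    ⟨(x, 0), (touches_iff x y x 0).2 (Or.inl (Or.inl (inCube_self x))), Or.inl rfl⟩
    ⟨(y, 0), (touches_iff x y y 0).2 (Or.inl (Or.inr (inCube_self y))), Or.inl rfl⟩⟩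

end Summit.QuantumFields.QCD.Cruxes.FrameAPrioriBound.CubeCofactor

end
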